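import Literature.MathematicalPhysics.QuantumLattice.HubbardNNNHoppingParticleHole
import Literature.MathematicalPhysics.QuantumLattice.HubbardChainFreeFermionEnergyDensity
import Literature.MathematicalPhysics.QuantumLattice.HubbardChainEnergyDensityVariationalPrinciple
import Literature.MathematicalPhysics.QuantumLattice.LatticeVectorHoppingInteraction
import Literature.MathematicalPhysics.QuantumLattice.InfVolFermionStateLatticeMapPullback
import Literature.MathematicalPhysics.QuantumLattice.HubbardHoppingFamilyLatticeSymmetry
import Literature.MathematicalPhysics.QuantumLattice.InfVolFermionStateMixture
import Literature.MathematicalPhysics.QuantumLattice.LayeredLatticeEnergyTransport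
import HarnessLib

/-!
# THE SINGLE-DIRECTION KINEMATIC ROW `|K_v(ω)| ≤ (4/π)|t|` for every translation-invariant state and every lattice
# vector, from the free Fermi CHAIN; the sharp interlayer allowance `(4/π)Σ|t_z|` of layered crystals

Topic `Literature/MathematicalPhysics/QuantumLattice` (namespace = path; family `hubbard`). The tree's class constant for the
bond energy `K_v(ω) = e_{Φ_v^t}(ω)` of ONE hopping vector `v` was the norm row `2|t|` (`abs_meanEnergy_vectorHopping_le`); for
PAIRS of directions it had the free-square-lattice rows `16/π²` (`IsTranslationInvariant.abs_meanEnergy_vectorHopping_add_le`). This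
file proves the sharp single-direction row `(4/π)|t|` — the ground-state energy of the free Fermi chain per bond (Lieb–Wu 2003 §6
Remark (A): `E/N_a = −4/π` at `U = 0`, both spins) — for EVERY translation-invariant state of the lattice fermions on `ℤ^d` and
EVERY nonzero `v`, and rewrites the dimension-raising window of `LayeredLatticeEnergyTransport` with the allowance `(4/π)Σ_b|t_{z,b}|`
in place of `2Σ_b|t_{z,b}|`.

THE ARGUMENT. (§1) On a torus `(ℤ/Lℤ)^d` with `L` even the sign of `t` is immaterial in every particle-number sector
(`groundEnergyAt_fermionTorus_neg_t`: Lieb's staggered particle–hole conjugation composed with the uniform one,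
`groundEnergyAt_fermionTorus_particleHole_uniform`, exactly as `groundEnergy_hubbardRectTorusTT'_neg_t`); hence the chain's
thermodynamic-limit density `hubbardChainEnergyDensityAt t U p q` is even in `t` (`hubbardChainEnergyDensityAt_neg_t`, through the
even rings `2qm`), so the free value `−(4|t|/π) sin(πp/2q)` holds for every real `t` (`hubbardChainEnergyDensityAt_zero_abs`) and
`−4|t|/π ≤ e_chain(t, 0; p/q)`. (§2) For a translation-invariant `σ` on `ℤ` of rational interior density the chain's variational
principle (`IsTranslationInvariant.hubbardChainEnergyDensityAt_le_hubbardEnergyDensity`) at `t = ±1` gives `|K(σ)| ≤ 4/π`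
(`…_of_density_eq_rat`); a general `σ` is mixed with a density-one state, the mixtures of rational density accumulate at weight `1`,
and the bond energy is affine in the weight (`IsTranslationInvariant.abs_meanEnergy_unitHop_le`). (§3) For `ω` on `ℤ^d` and `v ≠ 0`
pull back along the line `k ↦ k•v` (`lineHom`; `meanEnergy_vectorHopping_mapAct`): **`IsTranslationInvariant.abs_meanEnergy_vectorHopping_le_four_div_pi`**.
(§4) The sharp layered windows: `…_layeredModel_mem_Icc_sharp`, `…_layeredHubbardTTPrime_mem_Icc_sharp`,
`…_verticalHubbardTTPrime_mem_Icc_sharp` (`[e_ρ − (4/π)Σ|t_z|, e_ρ]`; `4/π ≈ 1.273` vs `2`) and the sharp word transfer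
`layeredModel/layeredHubbardTTPrime_energyWindow_word_mapAct_layerHom_sharp` (energy-window words with slack `ε + (4/π)Σ|t_z|`).

Everything is PROVED; definitions with bodies: `lineHom`; no named fact, no number. HONEST SCOPE: translation-invariant states (for
a PERIODIC stacking with inequivalent bond classes the per-class constant remains the norm row `2` — a dimerised bond can carry
`|K| = 2`); the row is per vector (for the axial pair `K₁` the free-square value `16/π² < 8/π` remains the better joint bound).

## Tree / Mathlib search

REUSED: `hamiltonian_particleHole_sameSign`, `groundEnergy_particleHole_transfer` (`HubbardNNNHoppingParticleHole`),
`groundEnergyAt_fermionTorus_particleHole` (`HubbardModelParticleHoleProofs`), `hubbardChainEnergyDensityAt(_mul)`,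
`tendsto_hubbardChainEnergyDensityAt` (`HubbardChainEnergyDensityAt`), `FreeFermionChain.hubbardChainEnergyDensityAt_zero`
(`HubbardChainFreeFermionEnergyDensity`), `IsTranslationInvariant.hubbardChainEnergyDensityAt_le_hubbardEnergyDensity`,
`exists_isTranslationInvariant_hubbardEnergyDensity_eq_chainAt` (`HubbardChainEnergyDensityVariationalPrinciple` / `…TorusLimitState`),
`hubbardFermionInteraction_eq_linearFamily_vectorHopping`, `vectorHoppingFermionInteraction_smul_apply`, `meanEnergy_vectorHopping_mapAct`
(`LatticeVectorHoppingInteraction`), `IsTranslationInvariant.meanEnergy_onSite_eq_mul_docc` (`HubbardHoppingFamilyLatticeSymmetry`),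
`mapAct`, `IsTranslationInvariant.mapAct` (`InfVolFermionStateLatticeMapPullback`), `mix`, `meanEnergy_mix`, `density_mix`,
`IsTranslationInvariant.mix`; `layeredModel`, `stack`, `meanEnergy_layeredModel_eq_mapAct_add`, `tiGroundEnergyDensityAt_layeredModel_le`,
`layeredHubbardTTPrime` (`LayeredLatticeEnergyTransport`); Mathlib `exists_rat_btwn`, `Rat.num_div_den`, `abs_add_le`.
Pattern: `groundEnergy_hubbardRectTorusTT'_neg_t`, `energyDensityTT'_neg_t` (`HubbardTTPrimeDiagonalUAnchors`).

## References

* E. H. Lieb, F. Y. Wu, Physica A 321 (2003) 1, §1 eq. (3) (particle–hole), §4 and §6 Remark (A) (the ideal Fermi gas,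
  `E/N_a = −4/π` at `U = 0`). [cite: LiebWuPhysicaA2003, §4 and §6 Remark (A)]
* F. H. L. Essler, H. Frahm, F. Göhmann, A. Klümper, V. E. Korepin, *The One-Dimensional Hubbard Model* (2005), §2.2.4
  eqs. (2.59)–(2.61) (particle–hole and sign conjugations). [cite: EsslerEtAl2005, §2.2.4 eqs. (2.59)–(2.61)]
* E. H. Lieb, *The Hubbard model: some rigorous results and open problems*, arXiv:cond-mat/9311033, §2 (bipartite gauge).
  [cite: arXiv9311033, §2]
* O. Bratteli, A. Kishimoto, D. W. Robinson, CMP 64 (1978) 41, Thm. 2 (variational principle). [cite: BratteliKishimotoRobinson1978, Thm. 2 (condition 2)]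
* O. Bratteli, D. W. Robinson, *OAQSM 1* (1987), §4.3.1 (restriction to subalgebras, convex combinations). [cite: BratteliRobinsonI1987, §4.3.1]
* H. Araki, H. Moriya, Rev. Math. Phys. 15 (2003) 93, §11.1 Theorem 11.2 (product states / layer marginals). [cite: ArakiMoriya2003, §11.1 Theorem 11.2]
-/

noncomputable section

namespace Literature.MathematicalPhysics.QuantumLattice

open Matrix Finset ThermodynamicLimit Literature.Probability.LatticeModels
open _root_.Filter
open scoped _root_.Topology ComplexOrder BigOperators

/-! ### §1. The sign of the nearest-neighbour hopping is immaterial on even tori and for the chain -/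

/-- **Uniform-sign particle–hole conjugation on the torus** (any `d`, `L`, `N ≤ 2L^d`):
`E_{t,U}(2L^d − N) = E_{−t,U}(N) − UN + UL^d` — the all-`+1` particle–hole unitary flips every hopping amplitude.
[cite: EsslerEtAl2005, §2.2.4 eqs. (2.59)–(2.61)] -/
theorem groundEnergyAt_fermionTorus_particleHole_uniform (d L : ℕ) (t U : ℝ) {N : ℕ} (hN : N ≤ 2 * L ^ d) :
    groundEnergyAt (fermionTorusGraph d L) t U (2 * L ^ d - N) =
      groundEnergyAt (fermionTorusGraph d L) (-t) U N - U * N + U * (L ^ d : ℕ) := by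
  have hcard : Fintype.card (FermionTorus d L) = L ^ d := by simp [FermionTorus, Fintype.card_lex]
  have hn : ∀ i : Orb (FermionTorus d L), ‖(((fun _ : FermionTorus d L => (1 : ℤˣ)) (ofLex i).1 : ℤ) : ℂ)‖ = 1 :=
    fun i => norm_intCast_units _
  have hconj := hamiltonian_particleHole_sameSign (fermionTorusGraph d L) t U (fun _ => (1 : ℤˣ)) (fun _ _ _ => rfl)
  have h := groundEnergy_particleHole_transfer _ hn hconj (N := N) (by rw [hcard]; exact hN)
  rw [hcard] at h
  unfold groundEnergyAt
  rw [h]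

/-- **The sign of `t` is immaterial on an even torus**: `E_{−t,U}(N) = E_{t,U}(N)` on `(ℤ/Lℤ)^d`, `L` even, every sector
(Lieb's staggered conjugation composed with the uniform one = the bipartite gauge `c_x ↦ (−1)^{Σx_i} c_x`). [cite: arXiv9311033, §2] -/
theorem groundEnergyAt_fermionTorus_neg_t {d L : ℕ} (hL : Even L) (t U : ℝ) {N : ℕ} (hN : N ≤ 2 * L ^ d) :
    groundEnergyAt (fermionTorusGraph d L) (-t) U N = groundEnergyAt (fermionTorusGraph d L) t U N := by
  have h1 := groundEnergyAt_fermionTorus_particleHole hL t U hN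
  have h2 := groundEnergyAt_fermionTorus_particleHole_uniform d L t U hN
  rw [h2] at h1
  push_cast at h1
  linarith

/-- **The chain's ground-state energy density is even in `t`**: `e(−t, U; p/q) = e(t, U; p/q)` (`U ≥ 0`; both are the
limit along the EVEN rings `2qm`, `hubbardChainEnergyDensityAt_mul`). [cite: arXiv9311033, §2] -/
theorem hubbardChainEnergyDensityAt_neg_t (t : ℝ) {U : ℝ} (hU : 0 ≤ U) {p q : ℕ} (hq : 1 ≤ q) (hp : p ≤ 2 * q) :
    hubbardChainEnergyDensityAt (-t) U p q = hubbardChainEnergyDensityAt t U p q := by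
  rw [← hubbardChainEnergyDensityAt_mul (-t) hU hq hp (k := 2) (by norm_num),
    ← hubbardChainEnergyDensityAt_mul t hU hq hp (k := 2) (by norm_num)]
  have h1 := tendsto_hubbardChainEnergyDensityAt (-t) hU (p := 2 * p) (q := 2 * q) (by omega) (by omega)
  have h2 := tendsto_hubbardChainEnergyDensityAt t hU (p := 2 * p) (q := 2 * q) (by omega) (by omega)
  refine tendsto_nhds_unique h1 (h2.congr fun m => ?_)
  rw [groundEnergyAt_fermionTorus_neg_t (d := 1) ⟨q * m, by ring⟩ t U (by rw [pow_one]; nlinarith)]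

/-- **The free Fermi chain for every real `t`**: `e(t, 0; p/q) = −(4|t|/π) sin(πp/2q)` (`1 ≤ p ≤ 2q`).
[cite: LiebWuPhysicaA2003, §4 and §6 Remark (A)] -/
theorem hubbardChainEnergyDensityAt_zero_abs {p q : ℕ} (hp1 : 1 ≤ p) (hp : p ≤ 2 * q) (t : ℝ) :
    hubbardChainEnergyDensityAt t 0 p q = -(4 * |t|) / Real.pi * Real.sin (Real.pi * p / (2 * q)) := by
  rcases le_total 0 t with ht | ht
  · rw [abs_of_nonneg ht]
    exact FreeFermionChain.hubbardChainEnergyDensityAt_zero hp1 hp ht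
  · have hq : 1 ≤ q := by omega
    rw [← hubbardChainEnergyDensityAt_neg_t t le_rfl hq hp, abs_of_nonpos ht,
      FreeFermionChain.hubbardChainEnergyDensityAt_zero hp1 hp (neg_nonneg.2 ht)]

/-- **`−4|t|/π ≤ e(t, 0; p/q)`** (`1 ≤ p ≤ 2q`). [cite: LiebWuPhysicaA2003, §4 and §6 Remark (A)] -/
theorem neg_four_mul_abs_div_pi_le_hubbardChainEnergyDensityAt_zero {p q : ℕ} (hp1 : 1 ≤ p) (hp : p ≤ 2 * q) (t : ℝ) :
    -(4 * |t| / Real.pi) ≤ hubbardChainEnergyDensityAt t 0 p q := by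
  rw [hubbardChainEnergyDensityAt_zero_abs hp1 hp t, neg_div, neg_mul, neg_le_neg_iff]
  have hs : Real.sin (Real.pi * p / (2 * q)) ≤ 1 := Real.sin_le_one _
  have h4 : 0 ≤ 4 * |t| / Real.pi := by positivity
  calc 4 * |t| / Real.pi * Real.sin (Real.pi * p / (2 * q)) ≤ 4 * |t| / Real.pi * 1 :=
      mul_le_mul_of_nonneg_left hs h4
    _ = 4 * |t| / Real.pi := mul_one _

/-! ### §2. The kinematic row on `ℤ` -/

namespace InfVolFermionState

/-- `e^{t,0}(σ) = t · K(σ)` for a translation-invariant `σ` on `ℤ`, `K(σ) = e_{Φ_{e₀}^1}(σ)` the unit-hop bond energy.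
[cite: BratteliKishimotoRobinson1978, §3 (mean energy functional)] -/
theorem IsTranslationInvariant.hubbardEnergyDensity_zero_eq_mul {σ : InfVolFermionState 1} (hσ : σ.IsTranslationInvariant)
    (t : ℝ) :
    σ.hubbardEnergyDensity t 0 = t * σ.meanEnergy (vectorHoppingFermionInteraction 1 (unitVec 0) 1) 1 := by
  rw [InfVolFermionState.hubbardEnergyDensity, hubbardFermionInteraction_eq_linearFamily_vectorHopping,
    meanEnergy_linearFamily, hσ.meanEnergy_onSite_eq_mul_docc, zero_mul, zero_add, Fin.sum_univ_one]

/-- **Rational interior densities**: a translation-invariant `σ` on `ℤ` with density `r ∈ ℚ ∩ (0,2)` has `|K(σ)| ≤ 4/π`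
(the chain's variational principle at `t = 1` and `t = −1` against the free value `−(4/π) sin ≥ −4/π`).
[cite: LiebWuPhysicaA2003, §4 and §6 Remark (A)] -/
theorem IsTranslationInvariant.abs_meanEnergy_unitHop_le_of_density_eq_rat {σ : InfVolFermionState 1}
    (hσ : σ.IsTranslationInvariant) {r : ℚ} (hr0 : 0 < r) (hr2 : r < 2) (hρ : σ.density = (r : ℝ)) :
    |σ.meanEnergy (vectorHoppingFermionInteraction 1 (unitVec 0) 1) 1| ≤ 4 / Real.pi := by
  -- write `r = p/q`
  set p : ℕ := r.num.toNat with hp_def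
  set q : ℕ := r.den with hq_def
  have hnum : (p : ℤ) = r.num := by rw [hp_def]; exact Int.toNat_of_nonneg (Rat.num_nonneg.2 hr0.le)
  have hq : 1 ≤ q := Nat.succ_le_of_lt r.den_pos
  have hqr : (0 : ℝ) < q := by exact_mod_cast (show 0 < q by omega)
  have hcast : ((r : ℚ) : ℝ) = (p : ℝ) / (q : ℝ) := by
    conv_lhs => rw [← Rat.num_div_den r]
    rw [Rat.cast_div, Rat.cast_intCast, Rat.cast_natCast]
    congr 1
    exact_mod_cast hnum.symm
  have hρ' : σ.density = (p : ℝ) / q := by rw [hρ, hcast]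
  have hr0' : (0 : ℝ) < (p : ℝ) / q := by rw [← hcast]; exact_mod_cast hr0
  have hr2' : (p : ℝ) / q < 2 := by rw [← hcast]; exact_mod_cast hr2
  have hp0 : 0 < p := by
    have : (0 : ℝ) < p := by
      have := mul_pos hr0' hqr; rwa [div_mul_cancel₀ _ hqr.ne'] at this
    exact_mod_cast this
  have hp2 : p < 2 * q := by
    have : (p : ℝ) < 2 * q := by rwa [div_lt_iff₀ hqr] at hr2'
    exact_mod_cast this
  set K := σ.meanEnergy (vectorHoppingFermionInteraction 1 (unitVec 0) 1) 1 with hK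
  -- `t = 1`: `-4/π ≤ e(1,0;p/q) ≤ K`
  have h1 := hσ.hubbardChainEnergyDensityAt_le_hubbardEnergyDensity 1 le_rfl hq hp0 hp2 hρ'
  rw [hσ.hubbardEnergyDensity_zero_eq_mul, one_mul] at h1
  have h1' := neg_four_mul_abs_div_pi_le_hubbardChainEnergyDensityAt_zero hp0 hp2.le (1 : ℝ)
  -- `t = -1`: `-4/π ≤ e(-1,0;p/q) ≤ -K`
  have h2 := hσ.hubbardChainEnergyDensityAt_le_hubbardEnergyDensity (-1) le_rfl hq hp0 hp2 hρ'
  rw [hσ.hubbardEnergyDensity_zero_eq_mul, neg_one_mul] at h2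
  have h2' := neg_four_mul_abs_div_pi_le_hubbardChainEnergyDensityAt_zero hp0 hp2.le (-1 : ℝ)
  rw [abs_one] at h1'
  rw [abs_neg, abs_one] at h2'
  rw [abs_le]
  constructor <;> linarith

/-- Weights near `1` at which the mixture `sσ + (1−s)τ` (`ρ(τ) = 1`) has RATIONAL interior density: for `ρ ∈ [0,2]` and
`δ ∈ (0,1]` there is `s ∈ [1−δ, 1]` with `sρ + (1−s) ∈ ℚ ∩ (0,2)`. [cite: BratteliRobinsonI1987, §4.3.1] -/
theorem exists_weight_rational_density {ρ δ : ℝ} (hρ0 : 0 ≤ ρ) (hρ2 : ρ ≤ 2) (hδ0 : 0 < δ) (hδ1 : δ ≤ 1) :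
    ∃ s : ℝ, 0 ≤ s ∧ s ≤ 1 ∧ 1 - δ ≤ s ∧ ∃ r : ℚ, 0 < r ∧ r < 2 ∧ s * ρ + (1 - s) * 1 = (r : ℝ) := by
  by_cases hρ1 : ρ = 1
  · exact ⟨1, zero_le_one, le_rfl, by linarith, 1, one_pos, by norm_num, by rw [hρ1]; norm_num⟩
  -- the density of the mixture at weight `1 - δ`
  set a := ρ - δ * (ρ - 1) with ha
  have ha0 : 0 < a := by rw [ha]; nlinarith
  have ha2 : a < 2 := by rw [ha]; nlinarith
  rcases lt_or_gt_of_ne hρ1 with hlt | hgt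
  · -- `ρ < 1`: densities increase from `ρ` (weight 1) to `a` (weight `1 - δ`)
    have hneg : ρ - 1 < 0 := by linarith
    have hρa : ρ < a := by rw [ha]; nlinarith
    obtain ⟨r, hr1, hr2⟩ := exists_rat_btwn hρa
    have ha1 : a ≤ 1 := by rw [ha]; nlinarith
    refine ⟨(r - 1) / (ρ - 1), div_nonneg_of_nonpos (by linarith) hneg.le, (div_le_one_of_neg hneg).2 (by linarith),
      (le_div_iff_of_neg hneg).2 (by rw [ha] at hr2; nlinarith), r, by exact_mod_cast hρ0.trans_lt hr1,
      by exact_mod_cast hr2.trans ha2, ?_⟩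
    field_simp
    ring
  · -- `ρ > 1`
    have hpos : 0 < ρ - 1 := by linarith
    have haρ : a < ρ := by rw [ha]; nlinarith
    obtain ⟨r, hr1, hr2⟩ := exists_rat_btwn haρ
    have ha1 : 1 ≤ a := by rw [ha]; nlinarith
    refine ⟨(r - 1) / (ρ - 1), div_nonneg (by linarith) hpos.le, (div_le_one hpos).2 (by linarith),
      (le_div_iff₀ hpos).2 (by rw [ha] at hr1; nlinarith), r, by exact_mod_cast ha0.trans (lt_of_le_of_lt le_rfl hr1),
      by exact_mod_cast hr2.trans_le hρ2, ?_⟩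
    field_simp
    ring

/-- **THE KINEMATIC ROW ON `ℤ`**: `|K(σ)| ≤ 4/π` for EVERY translation-invariant state `σ` of the lattice fermions on `ℤ`
(mix with a density-one state; the bond energy is affine in the weight and bounded by `4/π` on a set of weights accumulating
at `1`). [cite: LiebWuPhysicaA2003, §4 and §6 Remark (A)] -/
theorem IsTranslationInvariant.abs_meanEnergy_unitHop_le {σ : InfVolFermionState 1} (hσ : σ.IsTranslationInvariant) :
    |σ.meanEnergy (vectorHoppingFermionInteraction 1 (unitVec 0) 1) 1| ≤ 4 / Real.pi := by
  -- a translation-invariant state of density `1`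
  obtain ⟨τ, hτ, -, hτ1, -⟩ := exists_isTranslationInvariant_hubbardEnergyDensity_eq_chainAt (t := 0) (U := 0) le_rfl
    (p := 1) (q := 1) le_rfl (by norm_num)
  rw [Nat.cast_one, div_one] at hτ1
  set Ψ := vectorHoppingFermionInteraction 1 (unitVec (0 : Fin 1)) 1 with hΨ
  set K := σ.meanEnergy Ψ 1 with hK
  set Kτ := τ.meanEnergy Ψ 1 with hKτ
  -- mixtures with rational interior density obey the bound
  have hmix : ∀ s : ℝ, ∀ hs0 : 0 ≤ s, ∀ hs1 : s ≤ 1, ∀ r : ℚ, 0 < r → r < 2 →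
      s * σ.density + (1 - s) * 1 = (r : ℝ) → |s * K + (1 - s) * Kτ| ≤ 4 / Real.pi := by
    intro s hs0 hs1 r hr0 hr2 hdens
    have hTI := hσ.mix hτ s hs0 hs1
    have h := hTI.abs_meanEnergy_unitHop_le_of_density_eq_rat hr0 hr2
      (by rw [density_mix, hτ1]; exact hdens)
    rwa [meanEnergy_mix] at h
  by_contra hcon
  push Not at hcon
  -- choose `δ` with `δ |K - Kτ| < |K| - 4/π`
  obtain ⟨δ, hδ0, hδ1, hδ⟩ : ∃ δ : ℝ, 0 < δ ∧ δ ≤ 1 ∧ δ * |K - Kτ| < |K| - 4 / Real.pi := by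
    refine ⟨min 1 ((|K| - 4 / Real.pi) / (2 * (|K - Kτ| + 1))), lt_min one_pos (by
      have : 0 < |K| - 4 / Real.pi := by linarith
      positivity), min_le_left _ _, ?_⟩
    calc min 1 ((|K| - 4 / Real.pi) / (2 * (|K - Kτ| + 1))) * |K - Kτ|
        ≤ (|K| - 4 / Real.pi) / (2 * (|K - Kτ| + 1)) * |K - Kτ| :=
          mul_le_mul_of_nonneg_right (min_le_right _ _) (abs_nonneg _)
      _ < |K| - 4 / Real.pi := by
          rw [div_mul_eq_mul_div, div_lt_iff₀ (by positivity)]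
          nlinarith [abs_nonneg (K - Kτ), show 0 < |K| - 4 / Real.pi by linarith]
  obtain ⟨s, hs0, hs1, hsδ, r, hr0, hr2, hdens⟩ :=
    exists_weight_rational_density σ.density_nonneg σ.density_le_two hδ0 hδ1
  have hb := hmix s hs0 hs1 r hr0 hr2 hdens
  have hsplit : K = (s * K + (1 - s) * Kτ) + (1 - s) * (K - Kτ) := by ring
  have htri : |K| ≤ |s * K + (1 - s) * Kτ| + (1 - s) * |K - Kτ| := by
    calc |K| = |(s * K + (1 - s) * Kτ) + (1 - s) * (K - Kτ)| := by rw [← hsplit]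
      _ ≤ |s * K + (1 - s) * Kτ| + |(1 - s) * (K - Kτ)| := abs_add_le _ _
      _ = |s * K + (1 - s) * Kτ| + (1 - s) * |K - Kτ| := by rw [abs_mul, abs_of_nonneg (show (0 : ℝ) ≤ 1 - s by linarith)]
  have h3 : (1 - s) * |K - Kτ| ≤ δ * |K - Kτ| := mul_le_mul_of_nonneg_right (by linarith) (abs_nonneg _)
  linarith

end InfVolFermionState

/-! ### §3. The single-direction kinematic row on `ℤ^d` -/

section Row

variable {d : ℕ}

/-- **The line through the origin along `v`**: the additive map `ℤ → ℤ^d`, `k ↦ k•v`. [cite: BratteliRobinsonI1987, §4.3.1] -/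
def lineHom (v : Site d) : Site 1 →+ Site d where
  toFun x := x 0 • v
  map_zero' := by simp
  map_add' x y := by rw [Pi.add_apply, add_smul]

/-- Unfolding the line map. [cite: BratteliRobinsonI1987, §4.3.1] -/
theorem lineHom_apply (v : Site d) (x : Site 1) : lineHom v x = x 0 • v := rfl

/-- The line map sends the unit step to `v`. [cite: BratteliRobinsonI1987, §4.3.1] -/
theorem lineHom_unitVec (v : Site d) : lineHom v (unitVec 0) = v := by
  rw [lineHom_apply, unitVec, Pi.single_eq_same, one_smul]

/-- The line map of a nonzero vector is injective (`ℤ^d` is torsion free). [cite: BratteliRobinsonI1987, §4.3.1] -/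
theorem lineHom_injective {v : Site d} (hv : v ≠ 0) : Function.Injective (lineHom v) := by
  intro x y hxy
  rw [lineHom_apply, lineHom_apply] at hxy
  obtain ⟨i, hi⟩ : ∃ i, v i ≠ 0 := by
    by_contra h; push Not at h; exact hv (funext h)
  have h' := congrFun hxy i
  simp only [Pi.smul_apply, smul_eq_mul] at h'
  have hx : x 0 = y 0 := mul_right_cancel₀ hi h'
  funext j
  rw [Fin.fin_one_eq_zero j, hx]

/-- **THE SINGLE-DIRECTION KINEMATIC ROW**: `|e_{Φ_v^t}(ω)| ≤ (4/π)|t|` for every translation-invariant state `ω` of the lattice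
fermions on `ℤ^d`, every nonzero lattice vector `v` and every range parameter containing `v` — the state pulled back along the
line `k ↦ k•v` is a translation-invariant state of `ℤ` with the same `v`-bond energy. [cite: LiebWuPhysicaA2003, §4 and §6 Remark (A)] -/
theorem InfVolFermionState.IsTranslationInvariant.abs_meanEnergy_vectorHopping_le_four_div_pi
    {ω : InfVolFermionState d} (hω : ω.IsTranslationInvariant) {v : Site d} (hv : v ≠ 0) (t : ℝ) {R : ℝ}
    (hvR : v ∈ thicken ({0} : Finset (Site d)) R) :
    |ω.meanEnergy (vectorHoppingFermionInteraction d v t) R| ≤ 4 / Real.pi * |t| := by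
  have hf := lineHom_injective hv
  have hσ := hω.mapAct (lineHom v) hf
  have hK := hσ.abs_meanEnergy_unitHop_le
  have hpull := ω.meanEnergy_vectorHopping_mapAct (lineHom v) hf (uvec_ne_zero (0 : Fin 1)) 1
    (unitVec_mem_thicken_one 0) (by rw [lineHom_unitVec]; exact hvR)
  rw [lineHom_unitVec] at hpull
  rw [hpull] at hK
  -- scale the amplitude
  have hsmul : ω.meanEnergy (vectorHoppingFermionInteraction d v t) R =
      t * ω.meanEnergy (vectorHoppingFermionInteraction d v 1) R := by
    unfold InfVolFermionState.meanEnergy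
    rw [FermionInteraction.meanEnergyObs_of_smul (c := (t : ℂ)) (fun X => by
      rw [← vectorHoppingFermionInteraction_smul_apply, mul_one]), map_smul, smul_eq_mul, Complex.re_ofReal_mul]
  rw [hsmul, abs_mul, mul_comm]
  exact mul_le_mul_of_nonneg_right hK (abs_nonneg t)

end Row

/-! ### §4. The sharp interlayer allowance of uniformly stacked crystals; word transfer -/

section Layered

variable {d : ℕ} {ι κ : Type*} [Fintype ι] [Fintype κ]

/-- **FLOOR, sharp constant**: every translation-invariant state of the layered crystal with density `ρ` has mean energy
`≥ e_ρ(one-band model on ℤ^d) − (4/π) Σ_b |tz_b|`. [cite: BratteliKishimotoRobinson1978, Thm. 2 (condition 2)] -/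
theorem InfVolFermionState.IsTranslationInvariant.tiGroundEnergyDensityAt_sub_le_meanEnergy_layeredModel_sharp
    {ω : InfVolFermionState (d + 1)}
    (hω : ω.IsTranslationInvariant) {ρ : ℝ} (hρ : ω.density = ρ) (U : ℝ) {u : ι → Site d} (hu : ∀ a, u a ≠ 0)
    (θ : ι → ℝ) {w : κ → Site (d + 1)} (hw : ∀ b, w b ≠ 0) (tz : κ → ℝ) {R R' : ℝ} (hR : 1 ≤ R) (hRR' : R ≤ R')
    (huR : ∀ a, u a ∈ thicken ({0} : Finset (Site d)) R) (hwR' : ∀ b, w b ∈ thicken ({0} : Finset (Site (d + 1))) R') :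
    (vectorHoppingModel U u θ).tiGroundEnergyDensityAt R ρ - 4 / Real.pi * ∑ b, |tz b| ≤
      ω.meanEnergy (layeredModel U u θ w tz) R' := by
  rw [hω.meanEnergy_layeredModel_eq_mapAct_add U hu θ w tz hR hRR' huR, Finset.mul_sum]
  have hTI : (ω.mapAct (layerHom d) (layerHom_injective d)).IsTranslationInvariant := hω.mapAct (layerHom d) (layerHom_injective d)
  have hρ' : (ω.mapAct (layerHom d) (layerHom_injective d)).density = ρ := by
    rw [InfVolFermionState.density_mapAct _ _ _ (map_zero _), hρ]
  have h1 := (vectorHoppingModel U u θ).tiGroundEnergyDensityAt_le_meanEnergy R hTI hρ'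
  have h2 : ∀ b, -(4 / Real.pi * |tz b|) ≤ tz b * ω.meanEnergy (vectorHoppingFermionInteraction (d + 1) (w b) 1) R' := by
    intro b
    have hK := hω.abs_meanEnergy_vectorHopping_le_four_div_pi (hw b) 1 (hwR' b)
    rw [abs_one, mul_one] at hK
    have : |tz b * ω.meanEnergy (vectorHoppingFermionInteraction (d + 1) (w b) 1) R'| ≤ 4 / Real.pi * |tz b| := by
      rw [abs_mul, mul_comm (4 / Real.pi)]; exact mul_le_mul_of_nonneg_left hK (abs_nonneg _)
    exact (abs_le.1 this).1
  have h3 : -(∑ b, 4 / Real.pi * |tz b|) ≤ ∑ b, tz b * ω.meanEnergy (vectorHoppingFermionInteraction (d + 1) (w b) 1) R' := by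
    rw [← Finset.sum_neg_distrib]; exact Finset.sum_le_sum fun b _ => h2 b
  linarith

/-- **FLOOR (dimension raising), sharp constant**: `e_ρ(one-band, ℤ^d) − (4/π)Σ_b|tz_b| ≤ e_ρ(layered crystal)`.
[cite: BratteliKishimotoRobinson1978, Thm. 2 (condition 2)] -/
theorem tiGroundEnergyDensityAt_sub_le_layeredModel_sharp (hd : 0 < d) {ρ : ℝ}
    (hne : ∃ ω₀ : InfVolFermionState d, ω₀.IsTranslationInvariant ∧ ω₀.density = ρ)
    (U : ℝ) {u : ι → Site d} (hu : ∀ a, u a ≠ 0) (θ : ι → ℝ) {w : κ → Site (d + 1)} (hw : ∀ b, w b 0 ≠ 0)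
    (tz : κ → ℝ) {R R' : ℝ} (hR : 1 ≤ R) (hRR' : R ≤ R') (huR : ∀ a, u a ∈ thicken ({0} : Finset (Site d)) R)
    (hwR' : ∀ b, w b ∈ thicken ({0} : Finset (Site (d + 1))) R') :
    (vectorHoppingModel U u θ).tiGroundEnergyDensityAt R ρ - 4 / Real.pi * ∑ b, |tz b| ≤
      (layeredModel U u θ w tz).tiGroundEnergyDensityAt R' ρ := by
  obtain ⟨ω₀, hω₀, hρ₀⟩ := hne
  have he := hω₀.isEven hd
  have hne' : ∃ ω : InfVolFermionState (d + 1), ω.IsTranslationInvariant ∧ ω.density = ρ :=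
    ⟨ω₀.stack he, InfVolFermionState.stack_isTranslationInvariant hω₀ he, by rw [InfVolFermionState.density_stack, hρ₀]⟩
  have hw0 : ∀ b, w b ≠ 0 := fun b h0 => hw b (by rw [h0]; rfl)
  exact (layeredModel U u θ w tz).le_tiGroundEnergyDensityAt R' hne' fun ω hω hρ =>
    hω.tiGroundEnergyDensityAt_sub_le_meanEnergy_layeredModel_sharp hρ U hu θ hw0 tz hR hRR' huR hwR'

/-- **THE SHARP DIMENSION-RAISING WINDOW**: `e_ρ(layered crystal) ∈ [e_ρ(one-band, ℤ^d) − (4/π)Σ_b|tz_b|, e_ρ(one-band, ℤ^d)]`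
(replaces the allowance `2Σ|tz_b|` of `tiGroundEnergyDensityAt_layeredModel_mem_Icc`). [cite: LiebWuPhysicaA2003, §4 and §6 Remark (A)] -/
theorem tiGroundEnergyDensityAt_layeredModel_mem_Icc_sharp (hd : 0 < d) {ρ : ℝ}
    (hne : ∃ ω₀ : InfVolFermionState d, ω₀.IsTranslationInvariant ∧ ω₀.density = ρ)
    (U : ℝ) {u : ι → Site d} (hu : ∀ a, u a ≠ 0) (θ : ι → ℝ) {w : κ → Site (d + 1)} (hw : ∀ b, w b 0 ≠ 0)
    (tz : κ → ℝ) {R R' : ℝ} (hR : 1 ≤ R) (hRR' : R ≤ R') (huR : ∀ a, u a ∈ thicken ({0} : Finset (Site d)) R)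
    (hwR' : ∀ b, w b ∈ thicken ({0} : Finset (Site (d + 1))) R') :
    (layeredModel U u θ w tz).tiGroundEnergyDensityAt R' ρ ∈
      Set.Icc ((vectorHoppingModel U u θ).tiGroundEnergyDensityAt R ρ - 4 / Real.pi * ∑ b, |tz b|)
        ((vectorHoppingModel U u θ).tiGroundEnergyDensityAt R ρ) :=
  ⟨tiGroundEnergyDensityAt_sub_le_layeredModel_sharp hd hne U hu θ hw tz hR hRR' huR hwR',
    tiGroundEnergyDensityAt_layeredModel_le hd hne U hu θ hw tz hR hRR' huR hwR'⟩

/-- **`t–t'` Hubbard crystal, sharp window** (`U ≥ 0`, `0 < ρ < 2`): `[energyDensityTT' t t' U ρ − (4/π)Σ_b|tz_b|, energyDensityTT' t t' U ρ]`.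
[cite: LiebWuPhysicaA2003, §4 and §6 Remark (A)] -/
theorem tiGroundEnergyDensityAt_layeredHubbardTTPrime_mem_Icc_sharp (t t' : ℝ) {U : ℝ} (hU : 0 ≤ U) {ρ : ℝ}
    (hρ0 : 0 < ρ) (hρ2 : ρ < 2) {w : κ → Site 3} (hw : ∀ b, w b 0 ≠ 0) (tz : κ → ℝ) {R' : ℝ} (hR' : 1 ≤ R')
    (hwR' : ∀ b, w b ∈ thicken ({0} : Finset (Site 3)) R') :
    (layeredHubbardTTPrime t t' U w tz).tiGroundEnergyDensityAt R' ρ ∈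
      Set.Icc (energyDensityTT' t t' U ρ - 4 / Real.pi * ∑ b, |tz b|) (energyDensityTT' t t' U ρ) := by
  rw [← tiGroundEnergyDensityAt_hubbardTTPrime_eq_energyDensityTT' t t' hU hρ0 hρ2,
    hubbardTTPrimeFermionInteraction_eq_vectorHoppingModel, layeredHubbardTTPrime]
  exact tiGroundEnergyDensityAt_layeredModel_mem_Icc_sharp two_pos (exists_isTranslationInvariant_density_eq hρ0 hρ2) U
    ttPrimeVec_ne_zero (ttPrimeAmp t t') hw tz le_rfl hR' ttPrimeVec_mem_thicken_one hwR'

/-- **Simple tetragonal stacking, sharp**: `[energyDensityTT' − (4/π)|t_z|, energyDensityTT']` (`1.273|t_z|` vs `2|t_z|`).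
[cite: LiebWuPhysicaA2003, §4 and §6 Remark (A)] -/
theorem tiGroundEnergyDensityAt_verticalHubbardTTPrime_mem_Icc_sharp (t t' : ℝ) {U : ℝ} (hU : 0 ≤ U) {ρ : ℝ}
    (hρ0 : 0 < ρ) (hρ2 : ρ < 2) (tz : ℝ) :
    (layeredHubbardTTPrime t t' U (fun _ : Fin 1 => (unitVec (0 : Fin 3) : Site 3)) fun _ => tz).tiGroundEnergyDensityAt 1 ρ ∈
      Set.Icc (energyDensityTT' t t' U ρ - 4 / Real.pi * |tz|) (energyDensityTT' t t' U ρ) := by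
  have h := tiGroundEnergyDensityAt_layeredHubbardTTPrime_mem_Icc_sharp t t' hU hρ0 hρ2
    (w := fun _ : Fin 1 => (unitVec (0 : Fin 3) : Site 3)) (fun _ => unitVec_zero_apply_zero_ne_zero) (fun _ => tz) le_rfl
    (fun _ => unitVec_mem_thicken_one 0)
  simpa using h

/-- **The layer marginal of a near-ground state of the crystal is a near-ground state of the one-band model, sharp slack**
`ε + (4/π)Σ_b|tz_b|` (twin of `meanEnergy_mapAct_layerHom_le_of_le`). [cite: ArakiMoriya2003, §11.1 Theorem 11.2] -/
theorem InfVolFermionState.IsTranslationInvariant.meanEnergy_mapAct_layerHom_le_of_le_sharp (hd : 0 < d)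
    {ω : InfVolFermionState (d + 1)} (hω : ω.IsTranslationInvariant) {ρ : ℝ}
    (hne : ∃ ω₀ : InfVolFermionState d, ω₀.IsTranslationInvariant ∧ ω₀.density = ρ)
    (U : ℝ) {u : ι → Site d} (hu : ∀ a, u a ≠ 0) (θ : ι → ℝ) {w : κ → Site (d + 1)} (hw : ∀ b, w b 0 ≠ 0)
    (tz : κ → ℝ) {R R' : ℝ} (hR : 1 ≤ R) (hRR' : R ≤ R') (huR : ∀ a, u a ∈ thicken ({0} : Finset (Site d)) R)
    (hwR' : ∀ b, w b ∈ thicken ({0} : Finset (Site (d + 1))) R') {ε : ℝ}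
    (hε : ω.meanEnergy (layeredModel U u θ w tz) R' ≤ (layeredModel U u θ w tz).tiGroundEnergyDensityAt R' ρ + ε) :
    (ω.mapAct (layerHom d) (layerHom_injective d)).meanEnergy (vectorHoppingModel U u θ) R ≤
      (vectorHoppingModel U u θ).tiGroundEnergyDensityAt R ρ + (ε + 4 / Real.pi * ∑ b, |tz b|) := by
  have hdec := hω.meanEnergy_layeredModel_eq_mapAct_add U hu θ w tz hR hRR' huR
  have hcap := tiGroundEnergyDensityAt_layeredModel_le hd hne U hu θ hw tz hR hRR' huR hwR'
  have hw0 : ∀ b, w b ≠ 0 := fun b h0 => hw b (by rw [h0]; rfl)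
  have h2 : ∀ b, -(4 / Real.pi * |tz b|) ≤ tz b * ω.meanEnergy (vectorHoppingFermionInteraction (d + 1) (w b) 1) R' := by
    intro b
    have hK := hω.abs_meanEnergy_vectorHopping_le_four_div_pi (hw0 b) 1 (hwR' b)
    rw [abs_one, mul_one] at hK
    have : |tz b * ω.meanEnergy (vectorHoppingFermionInteraction (d + 1) (w b) 1) R'| ≤ 4 / Real.pi * |tz b| := by
      rw [abs_mul, mul_comm (4 / Real.pi)]; exact mul_le_mul_of_nonneg_left hK (abs_nonneg _)
    exact (abs_le.1 this).1
  have h3 : -(∑ b, 4 / Real.pi * |tz b|) ≤ ∑ b, tz b * ω.meanEnergy (vectorHoppingFermionInteraction (d + 1) (w b) 1) R' := by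
    rw [← Finset.sum_neg_distrib]; exact Finset.sum_le_sum fun b _ => h2 b
  rw [Finset.mul_sum]
  linarith

/-- **ENERGY-WINDOW WORDS TRANSFER TO THE CRYSTAL, sharp slack** `ε + (4/π)Σ_b|tz_b|` (twin of
`layeredModel_energyWindow_word_mapAct_layerHom`). [cite: ArakiMoriya2003, §11.1 Theorem 11.2] -/
theorem layeredModel_energyWindow_word_mapAct_layerHom_sharp (hd : 0 < d) {ρ : ℝ}
    (hne : ∃ ω₀ : InfVolFermionState d, ω₀.IsTranslationInvariant ∧ ω₀.density = ρ)
    (U : ℝ) {u : ι → Site d} (hu : ∀ a, u a ≠ 0) (θ : ι → ℝ) {w : κ → Site (d + 1)} (hw : ∀ b, w b 0 ≠ 0)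
    (tz : κ → ℝ) {R R' : ℝ} (hR : 1 ≤ R) (hRR' : R ≤ R') (huR : ∀ a, u a ∈ thicken ({0} : Finset (Site d)) R)
    (hwR' : ∀ b, w b ∈ thicken ({0} : Finset (Site (d + 1))) R') {P : InfVolFermionState d → Prop} {ε : ℝ}
    (hword : ∀ σ : InfVolFermionState d, σ.IsTranslationInvariant → σ.density = ρ →
      σ.meanEnergy (vectorHoppingModel U u θ) R ≤ (vectorHoppingModel U u θ).tiGroundEnergyDensityAt R ρ + (ε + 4 / Real.pi * ∑ b, |tz b|) →
        P σ)
    {ω : InfVolFermionState (d + 1)} (hω : ω.IsTranslationInvariant) (hρ : ω.density = ρ)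
    (hε : ω.meanEnergy (layeredModel U u θ w tz) R' ≤ (layeredModel U u θ w tz).tiGroundEnergyDensityAt R' ρ + ε) :
    P (ω.mapAct (layerHom d) (layerHom_injective d)) :=
  hword _ (hω.mapAct (layerHom d) (layerHom_injective d))
    (by rw [InfVolFermionState.density_mapAct _ _ _ (map_zero _), hρ])
    (hω.meanEnergy_mapAct_layerHom_le_of_le_sharp hd hne U hu θ hw tz hR hRR' huR hwR' hε)

/-- **`t–t'` instance of the sharp word transfer** (`U ≥ 0`, `0 < ρ < 2`; slack `ε + (4/π)Σ_b|tz_b|` above `energyDensityTT'`).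
[cite: ArakiMoriya2003, §11.1 Theorem 11.2] -/
theorem layeredHubbardTTPrime_energyWindow_word_mapAct_layerHom_sharp (t t' : ℝ) {U : ℝ} (hU : 0 ≤ U) {ρ : ℝ}
    (hρ0 : 0 < ρ) (hρ2 : ρ < 2) {w : κ → Site 3} (hw : ∀ b, w b 0 ≠ 0) (tz : κ → ℝ) {R' : ℝ} (hR' : 1 ≤ R')
    (hwR' : ∀ b, w b ∈ thicken ({0} : Finset (Site 3)) R') {P : InfVolFermionState 2 → Prop} {ε : ℝ}
    (hword : ∀ σ : InfVolFermionState 2, σ.IsTranslationInvariant → σ.density = ρ →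
      σ.meanEnergy (hubbardTTPrimeFermionInteraction t t' U) 1 ≤ energyDensityTT' t t' U ρ + (ε + 4 / Real.pi * ∑ b, |tz b|) → P σ)
    {ω : InfVolFermionState 3} (hω : ω.IsTranslationInvariant) (hρ : ω.density = ρ)
    (hε : ω.meanEnergy (layeredHubbardTTPrime t t' U w tz) R' ≤
      (layeredHubbardTTPrime t t' U w tz).tiGroundEnergyDensityAt R' ρ + ε) :
    P (ω.mapAct (layerHom 2) (layerHom_injective 2)) := by
  refine layeredModel_energyWindow_word_mapAct_layerHom_sharp two_pos (exists_isTranslationInvariant_density_eq hρ0 hρ2) U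
    ttPrimeVec_ne_zero (ttPrimeAmp t t') hw tz le_rfl hR' ttPrimeVec_mem_thicken_one hwR' (fun σ hσ hσρ hσe => ?_) hω hρ hε
  refine hword σ hσ hσρ ?_
  rwa [← hubbardTTPrimeFermionInteraction_eq_vectorHoppingModel,
    tiGroundEnergyDensityAt_hubbardTTPrime_eq_energyDensityTT' t t' hU hρ0 hρ2] at hσe

end Layered

/-! ### §5 (append). Sharp box words in the S2-seam shape -/

section BoxWordsSharp

variable {κ : Type*} [Fintype κ]

/-- **2D BOX WORD ⇒ 3D CRYSTAL BOX WORD, sharp constant** (S2-seam shape `θ = (U/t, t′/t, n)`, `t ≡ 1`): a 2D box word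
`[lo, hi]` on a parameter set with `U ≥ 0`, `0 < n < 2` is, for every interlayer pattern (`(w_b)₀ ≠ 0`, range box `R' ≥ 1`),
the crystal word `[lo − (4/π)Σ_b|tz_b|, hi]`. [cite: LiebWuPhysicaA2003, §4 and §6 Remark (A)] -/
theorem layeredHubbardTTPrime_boxword_of_boxword_sharp {B : Set (Fin 3 → ℝ)} {lo hi : ℝ}
    (hB : ∀ θ ∈ B, 0 ≤ θ 0 ∧ 0 < θ 2 ∧ θ 2 < 2)
    (hword : ∀ θ ∈ B, lo ≤ energyDensityTT' 1 (θ 1) (θ 0) (θ 2) ∧ energyDensityTT' 1 (θ 1) (θ 0) (θ 2) ≤ hi)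
    {w : κ → Site 3} (hw : ∀ b, w b 0 ≠ 0) (tz : κ → ℝ) {R' : ℝ} (hR' : 1 ≤ R')
    (hwR' : ∀ b, w b ∈ thicken ({0} : Finset (Site 3)) R') :
    ∀ θ ∈ B, lo - 4 / Real.pi * ∑ b, |tz b| ≤ (layeredHubbardTTPrime 1 (θ 1) (θ 0) w tz).tiGroundEnergyDensityAt R' (θ 2) ∧
      (layeredHubbardTTPrime 1 (θ 1) (θ 0) w tz).tiGroundEnergyDensityAt R' (θ 2) ≤ hi := by
  intro θ hθ
  obtain ⟨hU, hn0, hn2⟩ := hB θ hθ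
  have h := tiGroundEnergyDensityAt_layeredHubbardTTPrime_mem_Icc_sharp 1 (θ 1) hU hn0 hn2 hw tz hR' hwR'
  exact ⟨by linarith [h.1, (hword θ hθ).1], h.2.trans (hword θ hθ).2⟩

/-- **… with a box of interlayer amplitudes, sharp constant**: `Σ_b |tz_b| ≤ m` ⇒ the window `[lo − (4/π)m, hi]` uniformly.
[cite: LiebWuPhysicaA2003, §4 and §6 Remark (A)] -/
theorem layeredHubbardTTPrime_boxword_of_boxword_of_sum_le_sharp {B : Set (Fin 3 → ℝ)} {lo hi : ℝ}
    (hB : ∀ θ ∈ B, 0 ≤ θ 0 ∧ 0 < θ 2 ∧ θ 2 < 2)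
    (hword : ∀ θ ∈ B, lo ≤ energyDensityTT' 1 (θ 1) (θ 0) (θ 2) ∧ energyDensityTT' 1 (θ 1) (θ 0) (θ 2) ≤ hi)
    {w : κ → Site 3} (hw : ∀ b, w b 0 ≠ 0) {R' : ℝ} (hR' : 1 ≤ R') (hwR' : ∀ b, w b ∈ thicken ({0} : Finset (Site 3)) R')
    {m : ℝ} {tz : κ → ℝ} (htz : ∑ b, |tz b| ≤ m) :
    ∀ θ ∈ B, lo - 4 / Real.pi * m ≤ (layeredHubbardTTPrime 1 (θ 1) (θ 0) w tz).tiGroundEnergyDensityAt R' (θ 2) ∧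
      (layeredHubbardTTPrime 1 (θ 1) (θ 0) w tz).tiGroundEnergyDensityAt R' (θ 2) ≤ hi := by
  intro θ hθ
  have h := layeredHubbardTTPrime_boxword_of_boxword_sharp hB hword hw tz hR' hwR' θ hθ
  have hπ : 0 ≤ 4 / Real.pi := by positivity
  have h4 : 4 / Real.pi * ∑ b, |tz b| ≤ 4 / Real.pi * m := mul_le_mul_of_nonneg_left htz hπ
  exact ⟨by linarith [h.1], h.2⟩

/-- **Icc form, sharp constant**: on `Set.Icc lo₃ hi₃` (`lo₃ 0 ≥ 0`, `0 < lo₃ 2`, `hi₃ 2 < 2`) a 2D box word `[lo, hi]` is the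
crystal word `[lo − (4/π)m, hi]` for every interlayer pattern with `Σ_b |tz_b| ≤ m`. [cite: LiebWuPhysicaA2003, §4 and §6 Remark (A)] -/
theorem layeredHubbardTTPrime_boxword_Icc_sharp {lo₃ hi₃ : Fin 3 → ℝ} (hU : 0 ≤ lo₃ 0) (hn0 : 0 < lo₃ 2) (hn2 : hi₃ 2 < 2)
    {lo hi : ℝ}
    (hword : ∀ θ ∈ Set.Icc lo₃ hi₃, lo ≤ energyDensityTT' 1 (θ 1) (θ 0) (θ 2) ∧ energyDensityTT' 1 (θ 1) (θ 0) (θ 2) ≤ hi)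
    {w : κ → Site 3} (hw : ∀ b, w b 0 ≠ 0) {R' : ℝ} (hR' : 1 ≤ R') (hwR' : ∀ b, w b ∈ thicken ({0} : Finset (Site 3)) R')
    {m : ℝ} {tz : κ → ℝ} (htz : ∑ b, |tz b| ≤ m) :
    ∀ θ ∈ Set.Icc lo₃ hi₃, lo - 4 / Real.pi * m ≤ (layeredHubbardTTPrime 1 (θ 1) (θ 0) w tz).tiGroundEnergyDensityAt R' (θ 2) ∧
      (layeredHubbardTTPrime 1 (θ 1) (θ 0) w tz).tiGroundEnergyDensityAt R' (θ 2) ≤ hi :=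
  layeredHubbardTTPrime_boxword_of_boxword_of_sum_le_sharp
    (fun _ hθ => ⟨hU.trans (hθ.1 0), hn0.trans_le (hθ.1 2), (hθ.2 2).trans_lt hn2⟩) hword hw hR' hwR' htz

end BoxWordsSharp

end Literature.MathematicalPhysics.QuantumLattice
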